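/-
Copyright (c) 2026 the pub-hodgecm-mathlib formalisation cell (harness21).  Prover seat hodgecm-mathlib-LH7-p02 (g3), 2026-09-02 (line LH7, closer row `stub_PKtupleK2`,
#181 III-127; h413 = stmt-HodgeConjecture-24833; leaf `Cruxes/H413/Lines/F0_P3c_PKtuplePaydown.lean` ED. 3, organ `stub_PKsaU2 : PKsaU2Shape L` (O8a), in-house road
`F0/P3a/F0P3a-p03/g21/CENSUS-O8a-PKsaU2`, step 6 «LOCAL CLASSES EVERYWHERE» = sub-brick (6′) of the (6) assembly (F0P3a-p04 (g23) 09:06:07Z deal BY NAME)).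
-/
import Summits.HodgeConjecture.HodgeConjecture.Theorems.F0P3cPKtupleU1Line          -- ★ (γ′) `comap_mk_ofChar`, `isOpen_ker_comp_equiv`; brings ★ `F0P3cPKtupleHSideLetters` (`PKsaU2Shape`), ★ `F0P3GlobalPacketDiscrete` (`cmOccursInDiscreteSpectrum`), ★ `CharacterLineFinConstituents`, ★ `UnitaryGroupDetCharacter` (`cmDetChar`, `cmDetChar_inclPlaceAdelic`), ★ `IrreducibleClassesComap`
import Literature.NumberTheory.Automorphic.UnitaryGroupDetCharacterSection          -- ★ p850679 (this seat): (5b) `cm_exists_eq_cmDetChar_antidiagOne_two` — every automorphic character of `U(Φ₂)(𝔸_{L⁺})` is `θ ∘ det`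
import Literature.NumberTheory.Automorphic.IrreducibleClassesConstituents            -- ★ `IrrClass.nontrivial_of_isIrreducible`
import HarnessLib

/-!
# LH7 ∕ O8a step 6 «LOCAL CLASSES EVERYWHERE»: a family `π₂` of classes of the `U(Φ₂)(L⁺_v)` realised by a discrete automorphic `P` on which `U(Φ₂)(𝔸_{L⁺})`
# acts by `θ ∘ det` (equivalently `P = ofChar (θ ∘ det)⁻¹`) is, at EVERY finite place, the class of the character `θ_v ∘ det` ([Rogawski1990] §13.3 pp. 202–203)

Cell `hodgecm-mathlib` (D-0151), crux H413 = `stmt-HodgeConjecture-24833`, line LH7, letter O8a `PKsaU2Shape` (★ `Theorems/F0P3cPKtupleHSideLetters`).  THEOREMS ONLY (kernel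
lane `--kind proof --supports stmt-HodgeConjecture-24833 --as helper`): no `def`, no instance, no notation, no named fact, no `sorry`.

THE MATHEMATICS (the last arrow of the in-house road to O8a; its input is the output of the strong-approximation steps (K1)–(K4) + ★ p850670 «`P = ofChar Ψ μ₂`»
and ★ p850679 «`Ψ⁻¹ = θ ∘ det`»).  Let `P` be a discrete automorphic representation of the quasi-split `U(Φ₂)_{L∕L⁺}` on which `U(Φ₂)(𝔸_{L⁺})` acts by the scalars
`(θ ∘ det)(g)` (`θ` an automorphic character of the norm-one torus `U(1)_{L∕L⁺}(𝔸)`, ★ `cmDetChar`; e.g. `P = ofChar Ψ μ₂` with `Ψ⁻¹ = θ ∘ det`, since `R = Ψ⁻¹` on the line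
★ `ofChar_toContRep_apply`), and let `σ ↪ P|_{U(Φ₂)(𝔸_f)}` be an irreducible finite component (injective intertwiner, ★ `HasFinComponent`) whose constituents at every finite `v`
are EXACTLY the class `π₂ v` (the body of ★ `cmOccursInDiscreteSpectrum`).  Then: (§1) `σ` inherits the scalars along the injective intertwiner: `σ(y) = (θ ∘ det)(1, y)` on
`W_σ`; (§2) by ★ `CharacterLineFinConstituents` the constituents of `σ ∘ ι_v` are `{⟦ℂ_{(θ∘det) ∘ ι_v}⟧}`, so `comap (localPiEquiv v) (π₂ v) = ⟦ℂ_{(θ∘det) ∘ ι_v}⟧`; by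
★ `cmDetChar_inclPlaceAdelic` `(θ ∘ det) ∘ ι_v = (θ_v ∘ det_v) ∘ localPiEquiv v` (★ `torusLocalComponent`, ★ `localDet`), and transporting back along ★ `localPiEquiv v`
(★ `comap_mk_ofChar`, ★ `IrrClass.comap_injective`): **`π₂ v = ⟦ℂ_{θ_v ∘ det}⟧` for EVERY finite `v`** — no exceptional set.  (§3) From `P = ofChar Ψ μ₂` with `θ` produced by
★ p850679 (5b) applied to `Ψ⁻¹`: `∃ θ hθ hk, ∀ v, π₂ v = ⟦ℂ_{θ_v ∘ det}⟧` — the conclusion of `PKsaU2Shape L` VERBATIM.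

* §1 `apply_eq_smul_of_intertwiningMap_injective` (generic `F E c N J`) — a finite component inherits the scalars of `P`.
* §2 `isOpen_ker_torusLocalComponent_comp_localDet₂` (the open kernel of `θ_v ∘ det` on `U(Φ₂)(L⁺_v)`, from ★ `isOpen_ker_comp_inclPlaceAdelic` along ★ `localPiEquiv`),
  `comap_localPiEquiv_eq_mk_ofChar_of_forall_apply_eq_smul` (any continuous scalar character `χ`), **`forall_eq_mk_ofChar_of_forall_apply_eq_smul`** (`R = (θ∘det) •` ⇒
  `π₂ v = ⟦θ_v ∘ det⟧`) and its primed restatement with arbitrary open-kernel witnesses.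
* §3 **`exists_forall_eq_mk_ofChar_of_eq_ofChar`** (`P = ofChar Ψ μ₂` ⇒ `∃ θ hθ hk, ∀ v, π₂ v = ⟦θ_v ∘ det⟧`), `exists_forall_eq_mk_ofChar_of_exists_eq_ofChar`.

HONEST LABEL: count-neutral in-house glue (the leaf ED. 3 organ `stub_PKsaU2` stays a `sorry` until the (6) assembly of F0P3a-p04 (g23) composes (K1)–(K4) with ★ p850670, ★ p850679 and
this file); HC_CM is proved only modulo the 7 printed citations (2 remaining: hLiu418 = stmt-HodgeConjecture-24832, h413 = stmt-HodgeConjecture-24833) until rung 0 closes.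

## References
* [Rogawski1990] J. D. Rogawski, *Automorphic Representations of Unitary Groups in Three Variables*, Ann. of Math. Stud. 123 (1990), §13.3 pp. 202–203, §12.2 pp. 173–174.
* [BorelJacquet1979] A. Borel, H. Jacquet, *Automorphic forms and automorphic representations*, PSPM 33.1 (1979), §4.6.
* [FlathCorvallis1979] D. Flath, *Decomposition of representations into tensor products*, PSPM 33.1 (1979), Thm. 3.
* [BushnellHenniart2006] C. Bushnell, G. Henniart, *The local Langlands conjecture for GL(2)* (2006), §1.1 (smooth characters).
-/

set_option autoImplicit false
-- the mandated namespace repeats the single-problem summit's segment (`HodgeConjecture.HodgeConjecture`)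
set_option linter.dupNamespace false

noncomputable section

namespace Summit.HodgeConjecture.HodgeConjecture.Cruxes.H413.F0P3cPKtupleSaU2LocalClasses

open MeasureTheory NumberField IsDedekindDomain
open Literature.NumberTheory.Automorphic Literature.NumberTheory.Automorphic.UnitaryGroup
open Literature.NumberTheory.Rogawski1990 Literature.NumberTheory.GaloisRepresentations
open Literature.NumberTheory.Automorphic.Arthur2013.Leaves.TECR
open Summit.HodgeConjecture.HodgeConjecture.Cruxes.H413.F0P3GlobalPacketDiscrete
open Summit.HodgeConjecture.HodgeConjecture.Cruxes.H413.F0P3cPKtupleHSideLetters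
open Summit.HodgeConjecture.HodgeConjecture.Cruxes.H413.F0P3cPKtupleU1Line

universe u

/-! ## §1 A finite component inherits the scalars of `P` (generic `U(J)`) -/

section Generic

variable {F E : Type} [Field F] [NumberField F] [Field E] [NumberField E] [Algebra F E] {c : E ≃ₐ[F] E} {N : ℕ} {J : Matrix (Fin N) (Fin N) E}

/-- **A finite component inherits the scalars.**  If `U(J)(𝔸_F)` acts on the discrete automorphic `P` through the scalars `χ(g)` and `ι : σ → P|_{U(J)(𝔸_{F,f})}` is an
INJECTIVE intertwiner, then `σ(y) w = χ(1, y) • w` for every `y ∈ U(J)(𝔸_{F,f})` and `w ∈ W_σ` (`ι (σ y w) = R(1,y) (ι w) = χ(1,y) • ι w = ι (χ(1,y) • w)`).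
[cite: BorelJacquet1979, §4.6] [cite: FlathCorvallis1979, Thm. 3] -/
theorem apply_eq_smul_of_intertwiningMap_injective
    {μ : Measure (adelicGroupData F E c N J).automorphicQuotient} [(adelicGroupData F E c N J).IsAutomorphicMeasure μ]
    (P : DiscreteAutomorphicRep (adelicGroupData F E c N J) μ)
    {W : Type} [AddCommGroup W] [Module ℂ W] (σ : Representation ℂ (finAdelic F E c N J) W) (ι : σ.IntertwiningMap P.finRep) (hι : Function.Injective ι)
    (χ : (adelicGroupData F E c N J).Adelic →* ℂˣ)
    (hP : ∀ (g : (adelicGroupData F E c N J).Adelic) (f : P.space.toSubmodule), P.space.toContRep g f = ((χ g : ℂˣ) : ℂ) • f)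
    (y : finAdelic F E c N J) (w : W) :
    σ y w = ((χ (finAdelicToAdelic F E c N J y) : ℂˣ) : ℂ) • w := by
  apply hι
  rw [ι.isIntertwining, map_smul]
  exact hP _ (ι w)

end Generic

/-! ## §2 `U(Φ₂)`: from the scalars `θ ∘ det` on `P` to the local classes `⟦θ_v ∘ det⟧` of the realised family, at EVERY finite place -/

variable {L : Type} [Field L] [NumberField L] [IsCMField L]

/-- **The kernel of `θ_v ∘ det : U(Φ₂)(L⁺_v) → ℂˣ` is open** (`θ` an automorphic character of the norm-one torus): through ★ `localPiEquiv v` it is the kernel of the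
restriction `(θ ∘ det) ∘ ι_v` of the continuous adelic character `θ ∘ det` (★ `cmDetChar_inclPlaceAdelic`), open by ★ `isOpen_ker_comp_inclPlaceAdelic`.
[cite: Rogawski1990, §12.2 pp. 173–174] [cite: BushnellHenniart2006, §1.1] -/
theorem isOpen_ker_torusLocalComponent_comp_localDet₂ (θ : ↥(TorusDict.torus (IsCMField.complexConj L)) →ₜ* ℂˣ)
    (hθ : TorusDict.IsAutomorphic (IsCMField.complexConj L) θ) (v : HeightOneSpectrum (𝓞 ↥(maximalRealSubfield L))) :
    IsOpen (((((torusLocalComponent L (IsCMField.complexConj L) v θ).comp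
        (localDet (IsCMField.complexConj L) v (isUnit_antidiagOne_det L 2))).ker :
          Subgroup ↥(«local» L (IsCMField.complexConj L) 2 (Matrix.of fun i j : Fin 2 => if i.val + j.val + 1 = 2 then (1 : L) else 0) v)) :
            Set ↥(«local» L (IsCMField.complexConj L) 2 (Matrix.of fun i j : Fin 2 => if i.val + j.val + 1 = 2 then (1 : L) else 0) v))) := by
  set Θ := cmDetChar L 2 (Matrix.of fun i j : Fin 2 => if i.val + j.val + 1 = 2 then (1 : L) else 0) θ hθ (isUnit_antidiagOne_det L 2).ne_zero with hΘ
  set e := localPiEquiv L (IsCMField.complexConj L) 2 (Matrix.of fun i j : Fin 2 => if i.val + j.val + 1 = 2 then (1 : L) else 0) v with he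
  -- `(θ_v ∘ det) = ((Θ ∘ ι_v) ∘ e⁻¹)` as homomorphisms on the matrix model
  have hcomp : (torusLocalComponent L (IsCMField.complexConj L) v θ).comp (localDet (IsCMField.complexConj L) v (isUnit_antidiagOne_det L 2)) =
      ((Θ.toMonoidHom.comp (inclPlaceAdelic ↥(maximalRealSubfield L) L (IsCMField.complexConj L) 2
        (Matrix.of fun i j : Fin 2 => if i.val + j.val + 1 = 2 then (1 : L) else 0) v)).comp e.symm.toMonoidHom) := by
    refine MonoidHom.ext fun x => ?_
    change torusLocalComponent L (IsCMField.complexConj L) v θ (localDet (IsCMField.complexConj L) v (isUnit_antidiagOne_det L 2) x) =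
      Θ (inclPlaceAdelic ↥(maximalRealSubfield L) L (IsCMField.complexConj L) 2 (Matrix.of fun i j : Fin 2 => if i.val + j.val + 1 = 2 then (1 : L) else 0) v
        (e.symm x))
    rw [hΘ, cmDetChar_inclPlaceAdelic, ← he, ContinuousMulEquiv.apply_symm_apply]
  rw [hcomp]
  exact isOpen_ker_comp_equiv e.symm _ (isOpen_ker_comp_inclPlaceAdelic Θ.toMonoidHom Θ.continuous v)

/-- **Along ★ `localPiEquiv v`, the realised class is the class of the restricted scalar character.**  If `U(Φ₂)(𝔸_{L⁺})` acts on `P` through the scalars `χ(g)` (continuous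
`χ`) and the irreducible finite component `σ ↪ P|_{U(Φ₂)(𝔸_f)}` has constituents EXACTLY `comap (localPiEquiv v) (π₂ v)` at `v`, then
`comap (localPiEquiv v) (π₂ v) = ⟦ℂ_{χ ∘ ι_v}⟧` (§1 + ★ `IrrClass.isConstituentOf_comp_iff_eq_mk_ofChar_of_forall_apply_eq_smul`). [cite: BorelJacquet1979, §4.6] [cite: FlathCorvallis1979, Thm. 3] -/
theorem comap_localPiEquiv_eq_mk_ofChar_of_forall_apply_eq_smul
    {μ₂ : Measure (adelicGroupData ↥(maximalRealSubfield L) L (IsCMField.complexConj L) 2 (Matrix.of fun i j : Fin 2 => if i.val + j.val + 1 = 2 then (1 : L) else 0)).automorphicQuotient}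
    [(adelicGroupData ↥(maximalRealSubfield L) L (IsCMField.complexConj L) 2 (Matrix.of fun i j : Fin 2 => if i.val + j.val + 1 = 2 then (1 : L) else 0)).IsAutomorphicMeasure μ₂]
    (π₂ : ∀ v : HeightOneSpectrum (𝓞 ↥(maximalRealSubfield L)), IrrClass ((cmDatum L 2 (Matrix.of fun i j : Fin 2 => if i.val + j.val + 1 = 2 then (1 : L) else 0)).Local v))
    (P : DiscreteAutomorphicRep (adelicGroupData ↥(maximalRealSubfield L) L (IsCMField.complexConj L) 2 (Matrix.of fun i j : Fin 2 => if i.val + j.val + 1 = 2 then (1 : L) else 0)) μ₂)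
    {W : Type} [AddCommGroup W] [Module ℂ W]
    (σ : Representation ℂ (finAdelic ↥(maximalRealSubfield L) L (IsCMField.complexConj L) 2 (Matrix.of fun i j : Fin 2 => if i.val + j.val + 1 = 2 then (1 : L) else 0)) W)
    (hirr : σ.IsIrreducible) (hfin : P.HasFinComponent σ)
    (hconst : ∀ (v : HeightOneSpectrum (𝓞 ↥(maximalRealSubfield L)))
        (c₀ : IrrClass ↥(localPi L (IsCMField.complexConj L) 2 (Matrix.of fun i j : Fin 2 => if i.val + j.val + 1 = 2 then (1 : L) else 0) v)),
      c₀.IsConstituentOf (σ.comp (inclPlace ↥(maximalRealSubfield L) L (IsCMField.complexConj L) 2 (Matrix.of fun i j : Fin 2 => if i.val + j.val + 1 = 2 then (1 : L) else 0) v)) ↔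
        c₀ = IrrClass.comap (localPiEquiv L (IsCMField.complexConj L) 2 (Matrix.of fun i j : Fin 2 => if i.val + j.val + 1 = 2 then (1 : L) else 0) v) (π₂ v))
    (χ : (adelicGroupData ↥(maximalRealSubfield L) L (IsCMField.complexConj L) 2 (Matrix.of fun i j : Fin 2 => if i.val + j.val + 1 = 2 then (1 : L) else 0)).Adelic →* ℂˣ)
    (hχ : Continuous fun g => ((χ g : ℂˣ) : ℂ))
    (hP : ∀ (g : (adelicGroupData ↥(maximalRealSubfield L) L (IsCMField.complexConj L) 2 (Matrix.of fun i j : Fin 2 => if i.val + j.val + 1 = 2 then (1 : L) else 0)).Adelic)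
      (f : P.space.toSubmodule), P.space.toContRep g f = ((χ g : ℂˣ) : ℂ) • f)
    (v : HeightOneSpectrum (𝓞 ↥(maximalRealSubfield L))) :
    IrrClass.comap (localPiEquiv L (IsCMField.complexConj L) 2 (Matrix.of fun i j : Fin 2 => if i.val + j.val + 1 = 2 then (1 : L) else 0) v) (π₂ v) =
      IrrClass.mk (SmoothIrrep.ofChar (χ.comp (inclPlaceAdelic ↥(maximalRealSubfield L) L (IsCMField.complexConj L) 2
          (Matrix.of fun i j : Fin 2 => if i.val + j.val + 1 = 2 then (1 : L) else 0) v))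
        (isOpen_ker_comp_inclPlaceAdelic χ hχ v)) := by
  obtain ⟨ι, hι⟩ := hfin
  haveI : σ.IsIrreducible := hirr
  haveI : Nontrivial W := IrrClass.nontrivial_of_isIrreducible σ
  -- `σ` is `χ ∘ (1, ·)`-scalar
  have hsc : ∀ (y : finAdelic ↥(maximalRealSubfield L) L (IsCMField.complexConj L) 2 (Matrix.of fun i j : Fin 2 => if i.val + j.val + 1 = 2 then (1 : L) else 0)) (w : W),
      σ y w = (((χ.comp (finAdelicToAdelic ↥(maximalRealSubfield L) L (IsCMField.complexConj L) 2
        (Matrix.of fun i j : Fin 2 => if i.val + j.val + 1 = 2 then (1 : L) else 0))) y : ℂˣ) : ℂ) • w := fun y w =>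
    apply_eq_smul_of_intertwiningMap_injective P σ ι hι χ hP y w
  -- the constituents of `σ ∘ inclPlace v` are `{⟦(χ ∘ finAdelicToAdelic) ∘ inclPlace v⟧}`; the realised class is a constituent
  have h := (IrrClass.isConstituentOf_comp_iff_eq_mk_ofChar_of_forall_apply_eq_smul σ _
    (inclPlace ↥(maximalRealSubfield L) L (IsCMField.complexConj L) 2 (Matrix.of fun i j : Fin 2 => if i.val + j.val + 1 = 2 then (1 : L) else 0) v)
    (isOpen_ker_comp_inclPlaceAdelic χ hχ v) hsc _).1 ((hconst v _).2 rfl)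
  exact h

/-- **LOCAL CLASSES EVERYWHERE.**  If `U(Φ₂)(𝔸_{L⁺})` acts on the discrete automorphic `P` by the scalars `(θ ∘ det)(g)` for an automorphic character `θ` of
`U(1)_{L∕L⁺}(𝔸)` (★ `cmDetChar`), and the irreducible finite component `σ ↪ P|_{U(Φ₂)(𝔸_f)}` realises the family `π₂` (its constituents at every finite `v` are exactly `π₂ v` —
the body of ★ `cmOccursInDiscreteSpectrum`), then **`π₂ v = ⟦ℂ_{θ_v ∘ det}⟧` at EVERY finite place `v`** (★ `torusLocalComponent`, ★ `localDet`) — the conclusion of the letter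
`PKsaU2Shape L` for this `θ`: along ★ `localPiEquiv v` the realised class is `⟦(θ ∘ det) ∘ ι_v⟧` (`comap_localPiEquiv_eq_mk_ofChar_of_forall_apply_eq_smul`),
`(θ ∘ det) ∘ ι_v = (θ_v ∘ det) ∘ localPiEquiv v` (★ `cmDetChar_inclPlaceAdelic`), and ★ `comap_mk_ofChar` ∕ ★ `IrrClass.comap_injective` transport back.
[cite: Rogawski1990, §13.3 pp. 202–203; §12.2 pp. 173–174] [cite: BorelJacquet1979, §4.6] -/
theorem forall_eq_mk_ofChar_of_forall_apply_eq_smul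
    {μ₂ : Measure (adelicGroupData ↥(maximalRealSubfield L) L (IsCMField.complexConj L) 2 (Matrix.of fun i j : Fin 2 => if i.val + j.val + 1 = 2 then (1 : L) else 0)).automorphicQuotient}
    [(adelicGroupData ↥(maximalRealSubfield L) L (IsCMField.complexConj L) 2 (Matrix.of fun i j : Fin 2 => if i.val + j.val + 1 = 2 then (1 : L) else 0)).IsAutomorphicMeasure μ₂]
    (π₂ : ∀ v : HeightOneSpectrum (𝓞 ↥(maximalRealSubfield L)), IrrClass ((cmDatum L 2 (Matrix.of fun i j : Fin 2 => if i.val + j.val + 1 = 2 then (1 : L) else 0)).Local v))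
    (P : DiscreteAutomorphicRep (adelicGroupData ↥(maximalRealSubfield L) L (IsCMField.complexConj L) 2 (Matrix.of fun i j : Fin 2 => if i.val + j.val + 1 = 2 then (1 : L) else 0)) μ₂)
    {W : Type} [AddCommGroup W] [Module ℂ W]
    (σ : Representation ℂ (finAdelic ↥(maximalRealSubfield L) L (IsCMField.complexConj L) 2 (Matrix.of fun i j : Fin 2 => if i.val + j.val + 1 = 2 then (1 : L) else 0)) W)
    (hirr : σ.IsIrreducible) (hfin : P.HasFinComponent σ)
    (hconst : ∀ (v : HeightOneSpectrum (𝓞 ↥(maximalRealSubfield L)))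
        (c₀ : IrrClass ↥(localPi L (IsCMField.complexConj L) 2 (Matrix.of fun i j : Fin 2 => if i.val + j.val + 1 = 2 then (1 : L) else 0) v)),
      c₀.IsConstituentOf (σ.comp (inclPlace ↥(maximalRealSubfield L) L (IsCMField.complexConj L) 2 (Matrix.of fun i j : Fin 2 => if i.val + j.val + 1 = 2 then (1 : L) else 0) v)) ↔
        c₀ = IrrClass.comap (localPiEquiv L (IsCMField.complexConj L) 2 (Matrix.of fun i j : Fin 2 => if i.val + j.val + 1 = 2 then (1 : L) else 0) v) (π₂ v))
    (θ : ↥(TorusDict.torus (IsCMField.complexConj L)) →ₜ* ℂˣ) (hθ : TorusDict.IsAutomorphic (IsCMField.complexConj L) θ)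
    (hP : ∀ (g : (adelicGroupData ↥(maximalRealSubfield L) L (IsCMField.complexConj L) 2 (Matrix.of fun i j : Fin 2 => if i.val + j.val + 1 = 2 then (1 : L) else 0)).Adelic)
      (f : P.space.toSubmodule), P.space.toContRep g f =
        ((cmDetChar L 2 (Matrix.of fun i j : Fin 2 => if i.val + j.val + 1 = 2 then (1 : L) else 0) θ hθ (isUnit_antidiagOne_det L 2).ne_zero g : ℂˣ) : ℂ) • f)
    (v : HeightOneSpectrum (𝓞 ↥(maximalRealSubfield L))) :
    π₂ v = IrrClass.mk (SmoothIrrep.ofChar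
      ((torusLocalComponent L (IsCMField.complexConj L) v θ).comp (localDet (IsCMField.complexConj L) v (isUnit_antidiagOne_det L 2)))
      (isOpen_ker_torusLocalComponent_comp_localDet₂ θ hθ v)) := by
  set Θ := cmDetChar L 2 (Matrix.of fun i j : Fin 2 => if i.val + j.val + 1 = 2 then (1 : L) else 0) θ hθ (isUnit_antidiagOne_det L 2).ne_zero with hΘ
  set e := localPiEquiv L (IsCMField.complexConj L) 2 (Matrix.of fun i j : Fin 2 => if i.val + j.val + 1 = 2 then (1 : L) else 0) v with he
  -- step 1: along `e`, the realised class is `⟦Θ ∘ ι_v⟧`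
  have h1 := comap_localPiEquiv_eq_mk_ofChar_of_forall_apply_eq_smul π₂ P σ hirr hfin hconst Θ.toMonoidHom Θ.continuous hP v
  -- step 2: `(θ_v ∘ det) ∘ e = Θ ∘ ι_v` (★ `cmDetChar_inclPlaceAdelic`)
  have hk := isOpen_ker_torusLocalComponent_comp_localDet₂ θ hθ v
  have hpull : ((torusLocalComponent L (IsCMField.complexConj L) v θ).comp (localDet (IsCMField.complexConj L) v (isUnit_antidiagOne_det L 2))).comp e.toMonoidHom =
      Θ.toMonoidHom.comp (inclPlaceAdelic ↥(maximalRealSubfield L) L (IsCMField.complexConj L) 2 (Matrix.of fun i j : Fin 2 => if i.val + j.val + 1 = 2 then (1 : L) else 0) v) := by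
    refine MonoidHom.ext fun k => ?_
    change torusLocalComponent L (IsCMField.complexConj L) v θ (localDet (IsCMField.complexConj L) v (isUnit_antidiagOne_det L 2) (e k)) =
      Θ (inclPlaceAdelic ↥(maximalRealSubfield L) L (IsCMField.complexConj L) 2 (Matrix.of fun i j : Fin 2 => if i.val + j.val + 1 = 2 then (1 : L) else 0) v k)
    rw [hΘ, cmDetChar_inclPlaceAdelic, he]
  -- step 3: transport back along `e`
  apply IrrClass.comap_injective e
  rw [h1, comap_mk_ofChar e _ hk (isOpen_ker_comp_equiv e _ hk)]
  exact (IrrClass.mk_ofChar_eq_mk_ofChar_iff _ _).2 hpull.symm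

/-- The same with ANY open-kernel witnesses `hk v` (proof-irrelevant restatement — the exact shape of the letter's `∀ v, π₂ v = IrrClass.mk (SmoothIrrep.ofChar … (hk v))`).
[cite: Rogawski1990, §13.3 pp. 202–203] -/
theorem forall_eq_mk_ofChar_of_forall_apply_eq_smul'
    {μ₂ : Measure (adelicGroupData ↥(maximalRealSubfield L) L (IsCMField.complexConj L) 2 (Matrix.of fun i j : Fin 2 => if i.val + j.val + 1 = 2 then (1 : L) else 0)).automorphicQuotient}
    [(adelicGroupData ↥(maximalRealSubfield L) L (IsCMField.complexConj L) 2 (Matrix.of fun i j : Fin 2 => if i.val + j.val + 1 = 2 then (1 : L) else 0)).IsAutomorphicMeasure μ₂]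
    (π₂ : ∀ v : HeightOneSpectrum (𝓞 ↥(maximalRealSubfield L)), IrrClass ((cmDatum L 2 (Matrix.of fun i j : Fin 2 => if i.val + j.val + 1 = 2 then (1 : L) else 0)).Local v))
    (P : DiscreteAutomorphicRep (adelicGroupData ↥(maximalRealSubfield L) L (IsCMField.complexConj L) 2 (Matrix.of fun i j : Fin 2 => if i.val + j.val + 1 = 2 then (1 : L) else 0)) μ₂)
    {W : Type} [AddCommGroup W] [Module ℂ W]
    (σ : Representation ℂ (finAdelic ↥(maximalRealSubfield L) L (IsCMField.complexConj L) 2 (Matrix.of fun i j : Fin 2 => if i.val + j.val + 1 = 2 then (1 : L) else 0)) W)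
    (hirr : σ.IsIrreducible) (hfin : P.HasFinComponent σ)
    (hconst : ∀ (v : HeightOneSpectrum (𝓞 ↥(maximalRealSubfield L)))
        (c₀ : IrrClass ↥(localPi L (IsCMField.complexConj L) 2 (Matrix.of fun i j : Fin 2 => if i.val + j.val + 1 = 2 then (1 : L) else 0) v)),
      c₀.IsConstituentOf (σ.comp (inclPlace ↥(maximalRealSubfield L) L (IsCMField.complexConj L) 2 (Matrix.of fun i j : Fin 2 => if i.val + j.val + 1 = 2 then (1 : L) else 0) v)) ↔
        c₀ = IrrClass.comap (localPiEquiv L (IsCMField.complexConj L) 2 (Matrix.of fun i j : Fin 2 => if i.val + j.val + 1 = 2 then (1 : L) else 0) v) (π₂ v))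
    (θ : ↥(TorusDict.torus (IsCMField.complexConj L)) →ₜ* ℂˣ) (hθ : TorusDict.IsAutomorphic (IsCMField.complexConj L) θ)
    (hP : ∀ (g : (adelicGroupData ↥(maximalRealSubfield L) L (IsCMField.complexConj L) 2 (Matrix.of fun i j : Fin 2 => if i.val + j.val + 1 = 2 then (1 : L) else 0)).Adelic)
      (f : P.space.toSubmodule), P.space.toContRep g f =
        ((cmDetChar L 2 (Matrix.of fun i j : Fin 2 => if i.val + j.val + 1 = 2 then (1 : L) else 0) θ hθ (isUnit_antidiagOne_det L 2).ne_zero g : ℂˣ) : ℂ) • f)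
    (hk : ∀ v : HeightOneSpectrum (𝓞 ↥(maximalRealSubfield L)),
      IsOpen (((((torusLocalComponent L (IsCMField.complexConj L) v θ).comp (localDet (IsCMField.complexConj L) v (isUnit_antidiagOne_det L 2))).ker :
        Subgroup ↥(«local» L (IsCMField.complexConj L) 2 (Matrix.of fun i j : Fin 2 => if i.val + j.val + 1 = 2 then (1 : L) else 0) v)) :
          Set ↥(«local» L (IsCMField.complexConj L) 2 (Matrix.of fun i j : Fin 2 => if i.val + j.val + 1 = 2 then (1 : L) else 0) v))))
    (v : HeightOneSpectrum (𝓞 ↥(maximalRealSubfield L))) :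
    π₂ v = IrrClass.mk (SmoothIrrep.ofChar
      ((torusLocalComponent L (IsCMField.complexConj L) v θ).comp (localDet (IsCMField.complexConj L) v (isUnit_antidiagOne_det L 2))) (hk v)) :=
  forall_eq_mk_ofChar_of_forall_apply_eq_smul π₂ P σ hirr hfin hconst θ hθ hP v

/-! ## §3 From `P = ofChar Ψ μ₂` (the output of (K4) + ★ p850670) to the conclusion of `PKsaU2Shape L` via (5b) ★ p850679 -/

/-- **THE O8a TAIL.**  If the discrete automorphic `P` of `U(Φ₂)` realising the family `π₂` through an irreducible finite component `σ` (body of ★ `cmOccursInDiscreteSpectrum`) is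
the LINE `ofChar Ψ μ₂` of an automorphic character `Ψ` of `U(Φ₂)(𝔸_{L⁺})` (★ `DiscreteAutomorphicRep.ofChar`, on which `R(g) = Ψ(g)⁻¹`), then there is an automorphic character
`θ` of the norm-one torus `U(1)_{L∕L⁺}(𝔸)` (namely `Ψ⁻¹ = θ ∘ det`, ★ p850679 `cm_exists_eq_cmDetChar_antidiagOne_two`) with **`π₂ v = ⟦ℂ_{θ_v ∘ det}⟧` at EVERY finite place `v`**
— the conclusion `∃ θ hθ hk, ∀ v, π₂ v = IrrClass.mk (SmoothIrrep.ofChar ((torusLocalComponent v θ).comp (localDet v _)) (hk v))` of the letter `PKsaU2Shape L` VERBATIM.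
[cite: Rogawski1990, §13.3 pp. 202–203] [cite: BorelJacquet1979, §4.6] -/
theorem exists_forall_eq_mk_ofChar_of_eq_ofChar
    {μ₂ : Measure (adelicGroupData ↥(maximalRealSubfield L) L (IsCMField.complexConj L) 2 (Matrix.of fun i j : Fin 2 => if i.val + j.val + 1 = 2 then (1 : L) else 0)).automorphicQuotient}
    [(adelicGroupData ↥(maximalRealSubfield L) L (IsCMField.complexConj L) 2 (Matrix.of fun i j : Fin 2 => if i.val + j.val + 1 = 2 then (1 : L) else 0)).IsAutomorphicMeasure μ₂]
    (π₂ : ∀ v : HeightOneSpectrum (𝓞 ↥(maximalRealSubfield L)), IrrClass ((cmDatum L 2 (Matrix.of fun i j : Fin 2 => if i.val + j.val + 1 = 2 then (1 : L) else 0)).Local v))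
    (P : DiscreteAutomorphicRep (adelicGroupData ↥(maximalRealSubfield L) L (IsCMField.complexConj L) 2 (Matrix.of fun i j : Fin 2 => if i.val + j.val + 1 = 2 then (1 : L) else 0)) μ₂)
    {W : Type} [AddCommGroup W] [Module ℂ W]
    (σ : Representation ℂ (finAdelic ↥(maximalRealSubfield L) L (IsCMField.complexConj L) 2 (Matrix.of fun i j : Fin 2 => if i.val + j.val + 1 = 2 then (1 : L) else 0)) W)
    (hirr : σ.IsIrreducible) (hfin : P.HasFinComponent σ)
    (hconst : ∀ (v : HeightOneSpectrum (𝓞 ↥(maximalRealSubfield L)))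
        (c₀ : IrrClass ↥(localPi L (IsCMField.complexConj L) 2 (Matrix.of fun i j : Fin 2 => if i.val + j.val + 1 = 2 then (1 : L) else 0) v)),
      c₀.IsConstituentOf (σ.comp (inclPlace ↥(maximalRealSubfield L) L (IsCMField.complexConj L) 2 (Matrix.of fun i j : Fin 2 => if i.val + j.val + 1 = 2 then (1 : L) else 0) v)) ↔
        c₀ = IrrClass.comap (localPiEquiv L (IsCMField.complexConj L) 2 (Matrix.of fun i j : Fin 2 => if i.val + j.val + 1 = 2 then (1 : L) else 0) v) (π₂ v))
    (Ψ : (adelicGroupData ↥(maximalRealSubfield L) L (IsCMField.complexConj L) 2 (Matrix.of fun i j : Fin 2 => if i.val + j.val + 1 = 2 then (1 : L) else 0)).AutomorphicCharacter)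
    (hPΨ : P = DiscreteAutomorphicRep.ofChar Ψ μ₂) :
    ∃ (θ : ↥(TorusDict.torus (IsCMField.complexConj L)) →ₜ* ℂˣ) (_ : TorusDict.IsAutomorphic (IsCMField.complexConj L) θ)
      (hk : ∀ v : HeightOneSpectrum (𝓞 ↥(maximalRealSubfield L)),
        IsOpen (((((torusLocalComponent L (IsCMField.complexConj L) v θ).comp (localDet (IsCMField.complexConj L) v (isUnit_antidiagOne_det L 2))).ker :
          Subgroup ↥(«local» L (IsCMField.complexConj L) 2 (Matrix.of fun i j : Fin 2 => if i.val + j.val + 1 = 2 then (1 : L) else 0) v)) :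
            Set ↥(«local» L (IsCMField.complexConj L) 2 (Matrix.of fun i j : Fin 2 => if i.val + j.val + 1 = 2 then (1 : L) else 0) v)))),
      ∀ v : HeightOneSpectrum (𝓞 ↥(maximalRealSubfield L)),
        π₂ v = IrrClass.mk (SmoothIrrep.ofChar
          ((torusLocalComponent L (IsCMField.complexConj L) v θ).comp (localDet (IsCMField.complexConj L) v (isUnit_antidiagOne_det L 2))) (hk v)) := by
  -- (5b): `Ψ⁻¹ = θ ∘ det`
  obtain ⟨θ, hθ, hΘ⟩ := cm_exists_eq_cmDetChar_antidiagOne_two L Ψ⁻¹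
  -- `P = ofChar Ψ` acts by `Ψ⁻¹ = θ ∘ det`
  have hP : ∀ (g : (adelicGroupData ↥(maximalRealSubfield L) L (IsCMField.complexConj L) 2 (Matrix.of fun i j : Fin 2 => if i.val + j.val + 1 = 2 then (1 : L) else 0)).Adelic)
      (f : P.space.toSubmodule), P.space.toContRep g f =
        ((cmDetChar L 2 (Matrix.of fun i j : Fin 2 => if i.val + j.val + 1 = 2 then (1 : L) else 0) θ hθ (isUnit_antidiagOne_det L 2).ne_zero g : ℂˣ) : ℂ) • f := by
    subst hPΨ
    intro g f
    rw [DiscreteAutomorphicRep.ofChar_toContRep_apply, hΘ, AdelicGroupData.AutomorphicCharacter.coe_inv_apply]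
  exact ⟨θ, hθ, fun v => isOpen_ker_torusLocalComponent_comp_localDet₂ θ hθ v,
    fun v => forall_eq_mk_ofChar_of_forall_apply_eq_smul π₂ P σ hirr hfin hconst θ hθ hP v⟩

/-- **THE O8a TAIL, `∃`-form**: the same from `∃ Ψ, P = ofChar Ψ μ₂` (the literal output of ★ p850670 `exists_eq_ofChar_of_forall_apply_eq_self_of_commutator_mem_antidiagOne`).
[cite: Rogawski1990, §13.3 pp. 202–203] -/
theorem exists_forall_eq_mk_ofChar_of_exists_eq_ofChar
    {μ₂ : Measure (adelicGroupData ↥(maximalRealSubfield L) L (IsCMField.complexConj L) 2 (Matrix.of fun i j : Fin 2 => if i.val + j.val + 1 = 2 then (1 : L) else 0)).automorphicQuotient}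
    [(adelicGroupData ↥(maximalRealSubfield L) L (IsCMField.complexConj L) 2 (Matrix.of fun i j : Fin 2 => if i.val + j.val + 1 = 2 then (1 : L) else 0)).IsAutomorphicMeasure μ₂]
    (π₂ : ∀ v : HeightOneSpectrum (𝓞 ↥(maximalRealSubfield L)), IrrClass ((cmDatum L 2 (Matrix.of fun i j : Fin 2 => if i.val + j.val + 1 = 2 then (1 : L) else 0)).Local v))
    (P : DiscreteAutomorphicRep (adelicGroupData ↥(maximalRealSubfield L) L (IsCMField.complexConj L) 2 (Matrix.of fun i j : Fin 2 => if i.val + j.val + 1 = 2 then (1 : L) else 0)) μ₂)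
    {W : Type} [AddCommGroup W] [Module ℂ W]
    (σ : Representation ℂ (finAdelic ↥(maximalRealSubfield L) L (IsCMField.complexConj L) 2 (Matrix.of fun i j : Fin 2 => if i.val + j.val + 1 = 2 then (1 : L) else 0)) W)
    (hirr : σ.IsIrreducible) (hfin : P.HasFinComponent σ)
    (hconst : ∀ (v : HeightOneSpectrum (𝓞 ↥(maximalRealSubfield L)))
        (c₀ : IrrClass ↥(localPi L (IsCMField.complexConj L) 2 (Matrix.of fun i j : Fin 2 => if i.val + j.val + 1 = 2 then (1 : L) else 0) v)),
      c₀.IsConstituentOf (σ.comp (inclPlace ↥(maximalRealSubfield L) L (IsCMField.complexConj L) 2 (Matrix.of fun i j : Fin 2 => if i.val + j.val + 1 = 2 then (1 : L) else 0) v)) ↔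
        c₀ = IrrClass.comap (localPiEquiv L (IsCMField.complexConj L) 2 (Matrix.of fun i j : Fin 2 => if i.val + j.val + 1 = 2 then (1 : L) else 0) v) (π₂ v))
    (hPΨ : ∃ Ψ : (adelicGroupData ↥(maximalRealSubfield L) L (IsCMField.complexConj L) 2
      (Matrix.of fun i j : Fin 2 => if i.val + j.val + 1 = 2 then (1 : L) else 0)).AutomorphicCharacter, P = DiscreteAutomorphicRep.ofChar Ψ μ₂) :
    ∃ (θ : ↥(TorusDict.torus (IsCMField.complexConj L)) →ₜ* ℂˣ) (_ : TorusDict.IsAutomorphic (IsCMField.complexConj L) θ)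
      (hk : ∀ v : HeightOneSpectrum (𝓞 ↥(maximalRealSubfield L)),
        IsOpen (((((torusLocalComponent L (IsCMField.complexConj L) v θ).comp (localDet (IsCMField.complexConj L) v (isUnit_antidiagOne_det L 2))).ker :
          Subgroup ↥(«local» L (IsCMField.complexConj L) 2 (Matrix.of fun i j : Fin 2 => if i.val + j.val + 1 = 2 then (1 : L) else 0) v)) :
            Set ↥(«local» L (IsCMField.complexConj L) 2 (Matrix.of fun i j : Fin 2 => if i.val + j.val + 1 = 2 then (1 : L) else 0) v)))),
      ∀ v : HeightOneSpectrum (𝓞 ↥(maximalRealSubfield L)),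
        π₂ v = IrrClass.mk (SmoothIrrep.ofChar
          ((torusLocalComponent L (IsCMField.complexConj L) v θ).comp (localDet (IsCMField.complexConj L) v (isUnit_antidiagOne_det L 2))) (hk v)) := by
  obtain ⟨Ψ, hΨ⟩ := hPΨ
  exact exists_forall_eq_mk_ofChar_of_eq_ofChar π₂ P σ hirr hfin hconst Ψ hΨ

end Summit.HodgeConjecture.HodgeConjecture.Cruxes.H413.F0P3cPKtupleSaU2LocalClasses

end
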